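import Summits.Ventures.Crystal3D.Theorems.StickyWulffConstantCoaxialWallLawWordTargets
import Summits.Ventures.Crystal3D.Theorems.StickyWulffConstantCoaxialWallLawFluxGap
import Summits.Ventures.Crystal3D.Theorems.StickyWulffConstantCoaxialWallLawTwinFrames
import HarnessLib

/-!
# The `{111}` normals of the model lattice: faces, face normals, and the `±1/3` law

HONEST FRAMING. Part of the venture `Summits/Ventures/Crystal3D` (cell `crystal3d-full`), helper for the
crux `CoaxialWallLaw` (stmt-Ventures-19481) of `route-Ventures-StickyWulffConstant`, REGISTERED line
`WallLedgerF` (planner cf-p1 gen 16), open stub `stub_coaxialTwoSlabAdhesion` (general fillings).  Brick M1 of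
the v2 (NET) line automaton (memo F-NET-AUTOMATON-v2 §7, evidence on the crux item): model facts for the
letters of the word classes.  A MENU NORMAL of a frame `A` is a unit `m` with `⟪A w, m⟫ ∈ {0, ±√(2/3)}` for all
slots `w`.  Rung credit only; F-C1 not moved.

* `exists_face_of_slot` — every slot lies on a `60°` triangle of slots (a face of the cuboctahedron);
* `exists_menuNormal_far` — hence for every frame `A` and slot `u` there is a menu normal `m` of `A` with
  `⟪A u, m⟫ = +√(2/3)` (the face normal `A(u + v + w)/√6`);
* `norm_sq_of_inner_face` — a unit vector `μ'` with prescribed inner products `x, y, z` with a face `a, b, c`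
  is `Σ (2xᵢ − (x+y+z)/2) aᵢ`, so `1 = ‖μ'‖² = 2(x² + y² + z²) − (x + y + z)²/2`;
* `inner_menuNormals` — two menu normals of the same frame meet at `⟪m, m'⟫ ∈ {±1, ±1/3}` (the far face of
  `m` and the identity above leave only the patterns «one non-zero» and «three equal signs»).  This is the
  adjacency `±2 = ⟪√6 m, √6 m'⟫` consumed by `…NonReturn`.

WHAT THIS IS NOT: not the stub; F-C1 not moved.
-/

noncomputable section

namespace Summit.Ventures.Crystal3D.Theorems

open Summit.Ventures.Crystal3D Finset
open Literature.MathematicalPhysics.StatisticalMechanics (fccStacking)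
open scoped InnerProductSpace

/-- A model `60°` face: the far triple of `e₃` in the identity frame. -/
theorem exists_model_face : ∃ u₁ ∈ fccSlots, ∃ u₂ ∈ fccSlots, ∃ u₃ ∈ fccSlots,
    ⟪u₁, u₂⟫_ℝ = 1 / 2 ∧ ⟪u₁, u₃⟫_ℝ = 1 / 2 ∧ ⟪u₂, u₃⟫_ℝ = 1 / 2 := by
  set e₃ : EuclideanSpace ℝ (Fin 3) := EuclideanSpace.single (2 : Fin 3) (1 : ℝ) with he₃
  have he₃1 : ‖e₃‖ = 1 := by rw [he₃, PiLp.norm_single, norm_one]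
  have hmenu : ∀ w ∈ fccSlots,
      ⟪(LinearIsometryEquiv.refl ℝ (EuclideanSpace ℝ (Fin 3))) w, e₃⟫_ℝ = 0 ∨
      ⟪(LinearIsometryEquiv.refl ℝ (EuclideanSpace ℝ (Fin 3))) w, e₃⟫_ℝ = Real.sqrt (2 / 3) ∨
      ⟪(LinearIsometryEquiv.refl ℝ (EuclideanSpace ℝ (Fin 3))) w, e₃⟫_ℝ = -Real.sqrt (2 / 3) := by
    intro w hw
    rw [LinearIsometryEquiv.coe_refl, id, inner_single_two_one]
    exact slot_apply_two_cases hw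
  obtain ⟨u₁, hu₁, u₂, hu₂, u₃, hu₃, -, -, -, i12, i13, i23, -, -⟩ :=
    exists_far_frame (LinearIsometryEquiv.refl ℝ (EuclideanSpace ℝ (Fin 3))) he₃1 hmenu
  exact ⟨u₁, hu₁, u₂, hu₂, u₃, hu₃, i12, i13, i23⟩

open scoped Classical in
/-- **Every slot lies on a face.** -/
theorem exists_face_of_slot {u : EuclideanSpace ℝ (Fin 3)} (hu : u ∈ fccSlots) :
    ∃ v ∈ fccSlots, ∃ w ∈ fccSlots, ⟪u, v⟫_ℝ = 1 / 2 ∧ ⟪u, w⟫_ℝ = 1 / 2 ∧ ⟪v, w⟫_ℝ = 1 / 2 := by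
  obtain ⟨a, ha, b, hb, c, hc, iab, iac, ibc⟩ := exists_model_face
  have haa : ⟪a, a⟫_ℝ = 1 := by rw [real_inner_self_eq_norm_sq, norm_eq_one_of_mem_fccSlots ha, one_pow]
  have hbb : ⟪b, b⟫_ℝ = 1 := by rw [real_inner_self_eq_norm_sq, norm_eq_one_of_mem_fccSlots hb, one_pow]
  have hcc : ⟪c, c⟫_ℝ = 1 := by rw [real_inner_self_eq_norm_sq, norm_eq_one_of_mem_fccSlots hc, one_pow]
  have iba : ⟪b, a⟫_ℝ = 1 / 2 := by rw [real_inner_comm]; exact iab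
  have ica : ⟪c, a⟫_ℝ = 1 / 2 := by rw [real_inner_comm]; exact iac
  have icb : ⟪c, b⟫_ℝ = 1 / 2 := by rw [real_inner_comm]; exact ibc
  have hna := neg_mem_fccSlots ha
  have hnb := neg_mem_fccSlots hb
  have hnc := neg_mem_fccSlots hc
  have sab := sub_mem_fccSlots_of_inner_eq_half ha hb iab
  have sba := sub_mem_fccSlots_of_inner_eq_half hb ha iba
  have sac := sub_mem_fccSlots_of_inner_eq_half ha hc iac
  have sca := sub_mem_fccSlots_of_inner_eq_half hc ha ica
  have sbc := sub_mem_fccSlots_of_inner_eq_half hb hc ibc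
  have scb := sub_mem_fccSlots_of_inner_eq_half hc hb icb
  have hcl := fccSlots_eq_image_of_triangle ha hb hc iab iac ibc
  have hu' := hu
  rw [hcl, mem_image] at hu'
  obtain ⟨i, -, hi⟩ := hu'
  fin_cases i <;> simp at hi <;> subst hi
  · exact ⟨b, hb, c, hc, iab, iac, ibc⟩
  · exact ⟨a, ha, c, hc, iba, ibc, iac⟩
  · exact ⟨a, ha, b, hb, ica, icb, iab⟩
  · exact ⟨-b, hnb, -c, hnc, by simp [iab], by simp [iac], by simp [ibc]⟩
  · exact ⟨-a, hna, -c, hnc, by simp [iba], by simp [ibc], by simp [iac]⟩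
  · exact ⟨-a, hna, -b, hnb, by simp [ica], by simp [icb], by simp [iab]⟩
  · refine ⟨a - c, sac, a, ha, ?_, ?_, ?_⟩ <;>
      simp only [inner_sub_left, inner_sub_right, haa, iba, iac, ica, ibc] <;> norm_num
  · refine ⟨b - c, sbc, b, hb, ?_, ?_, ?_⟩ <;>
      simp only [inner_sub_left, inner_sub_right, hbb, iab, ibc, icb, iac] <;> norm_num
  · refine ⟨a - b, sab, a, ha, ?_, ?_, ?_⟩ <;>
      simp only [inner_sub_left, inner_sub_right, haa, iab, iba, ica, icb] <;> norm_num
  · refine ⟨c - b, scb, c, hc, ?_, ?_, ?_⟩ <;>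
      simp only [inner_sub_left, inner_sub_right, hcc, iac, ibc, icb, iab] <;> norm_num
  · refine ⟨b - a, sba, b, hb, ?_, ?_, ?_⟩ <;>
      simp only [inner_sub_left, inner_sub_right, hbb, iab, iba, icb, ica] <;> norm_num
  · refine ⟨c - a, sca, c, hc, ?_, ?_, ?_⟩ <;>
      simp only [inner_sub_left, inner_sub_right, hcc, iac, ica, ibc, iba] <;> norm_num

/-- The inner products of the face sum `a + b + c` with the slots: `0` or `±2`. -/
theorem inner_faceSum_slot {a b c : EuclideanSpace ℝ (Fin 3)} (ha : a ∈ fccSlots) (hb : b ∈ fccSlots)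
    (hc : c ∈ fccSlots) (iab : ⟪a, b⟫_ℝ = 1 / 2) (iac : ⟪a, c⟫_ℝ = 1 / 2) (ibc : ⟪b, c⟫_ℝ = 1 / 2)
    {w : EuclideanSpace ℝ (Fin 3)} (hw : w ∈ fccSlots) :
    ⟪w, a + b + c⟫_ℝ = 0 ∨ ⟪w, a + b + c⟫_ℝ = 2 ∨ ⟪w, a + b + c⟫_ℝ = -2 := by
  classical
  have haa : ⟪a, a⟫_ℝ = 1 := by rw [real_inner_self_eq_norm_sq, norm_eq_one_of_mem_fccSlots ha, one_pow]
  have hbb : ⟪b, b⟫_ℝ = 1 := by rw [real_inner_self_eq_norm_sq, norm_eq_one_of_mem_fccSlots hb, one_pow]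
  have hcc : ⟪c, c⟫_ℝ = 1 := by rw [real_inner_self_eq_norm_sq, norm_eq_one_of_mem_fccSlots hc, one_pow]
  have iba : ⟪b, a⟫_ℝ = 1 / 2 := by rw [real_inner_comm]; exact iab
  have ica : ⟪c, a⟫_ℝ = 1 / 2 := by rw [real_inner_comm]; exact iac
  have icb : ⟪c, b⟫_ℝ = 1 / 2 := by rw [real_inner_comm]; exact ibc
  have hcl := fccSlots_eq_image_of_triangle ha hb hc iab iac ibc
  have hw' := hw
  rw [hcl, mem_image] at hw'
  obtain ⟨i, -, hi⟩ := hw'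
  fin_cases i <;> simp at hi <;> subst hi <;>
    simp only [inner_add_right, inner_neg_left, inner_sub_left, haa, hbb, hcc, iab, iba, iac, ica, ibc, icb] <;>
    norm_num

/-- **The face normal.**  For a face `a, b, c` of slots, `μ = (a + b + c)/√6` is a unit menu normal of the
model with `⟪a, μ⟫ = √(2/3)`. -/
theorem faceNormal_props {a b c : EuclideanSpace ℝ (Fin 3)} (ha : a ∈ fccSlots) (hb : b ∈ fccSlots)
    (hc : c ∈ fccSlots) (iab : ⟪a, b⟫_ℝ = 1 / 2) (iac : ⟪a, c⟫_ℝ = 1 / 2) (ibc : ⟪b, c⟫_ℝ = 1 / 2) :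
    ‖(1 / Real.sqrt 6) • (a + b + c)‖ = 1 ∧
    (∀ w ∈ fccSlots, ⟪w, (1 / Real.sqrt 6) • (a + b + c)⟫_ℝ = 0 ∨
      ⟪w, (1 / Real.sqrt 6) • (a + b + c)⟫_ℝ = Real.sqrt (2 / 3) ∨
      ⟪w, (1 / Real.sqrt 6) • (a + b + c)⟫_ℝ = -Real.sqrt (2 / 3)) ∧
    ⟪a, (1 / Real.sqrt 6) • (a + b + c)⟫_ℝ = Real.sqrt (2 / 3) := by
  have h6 : 0 < Real.sqrt 6 := Real.sqrt_pos.2 (by norm_num)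
  have h66 : Real.sqrt 6 ^ 2 = 6 := Real.sq_sqrt (by norm_num)
  have hr6 : Real.sqrt (2 / 3) = 2 / Real.sqrt 6 := by
    rw [eq_div_iff h6.ne', show (6 : ℝ) = (2 / 3) * 9 by norm_num, Real.sqrt_mul (by norm_num),
      show (9 : ℝ) = 3 ^ 2 by norm_num, Real.sqrt_sq (by norm_num)]
    have h23 : Real.sqrt (2 / 3) * Real.sqrt (2 / 3) = 2 / 3 := Real.mul_self_sqrt (by norm_num)
    nlinarith [h23]
  have haa : ⟪a, a⟫_ℝ = 1 := by rw [real_inner_self_eq_norm_sq, norm_eq_one_of_mem_fccSlots ha, one_pow]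
  have hbb : ⟪b, b⟫_ℝ = 1 := by rw [real_inner_self_eq_norm_sq, norm_eq_one_of_mem_fccSlots hb, one_pow]
  have hcc : ⟪c, c⟫_ℝ = 1 := by rw [real_inner_self_eq_norm_sq, norm_eq_one_of_mem_fccSlots hc, one_pow]
  have iba : ⟪b, a⟫_ℝ = 1 / 2 := by rw [real_inner_comm]; exact iab
  have ica : ⟪c, a⟫_ℝ = 1 / 2 := by rw [real_inner_comm]; exact iac
  have icb : ⟪c, b⟫_ℝ = 1 / 2 := by rw [real_inner_comm]; exact ibc
  refine ⟨?_, ?_, ?_⟩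
  · have hsq : ‖a + b + c‖ ^ 2 = 6 := by
      rw [← real_inner_self_eq_norm_sq]
      simp only [inner_add_left, inner_add_right, haa, hbb, hcc, iab, iba, iac, ica, ibc, icb]
      norm_num
    have hn : ‖a + b + c‖ = Real.sqrt 6 := by
      rw [← Real.sqrt_sq (norm_nonneg (a + b + c)), hsq]
    rw [norm_smul, hn, Real.norm_eq_abs, abs_of_pos (by positivity)]
    field_simp
  · intro w hw
    rw [real_inner_smul_right]
    rcases inner_faceSum_slot ha hb hc iab iac ibc hw with h | h | h <;> rw [h]
    · exact Or.inl (by ring)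
    · exact Or.inr (Or.inl (by rw [hr6]; ring))
    · exact Or.inr (Or.inr (by rw [hr6]; ring))
  · rw [real_inner_smul_right, inner_add_right, inner_add_right, haa, iab, iac, hr6]
    ring

/-- **Every slot of every frame is far for some menu normal.** -/
theorem exists_menuNormal_far (A : EuclideanSpace ℝ (Fin 3) ≃ₗᵢ[ℝ] EuclideanSpace ℝ (Fin 3))
    {u : EuclideanSpace ℝ (Fin 3)} (hu : u ∈ fccSlots) :
    ∃ m : EuclideanSpace ℝ (Fin 3), ‖m‖ = 1 ∧
      (∀ w ∈ fccSlots, ⟪A w, m⟫_ℝ = 0 ∨ ⟪A w, m⟫_ℝ = Real.sqrt (2 / 3) ∨ ⟪A w, m⟫_ℝ = -Real.sqrt (2 / 3)) ∧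
      ⟪A u, m⟫_ℝ = Real.sqrt (2 / 3) := by
  obtain ⟨v, hv, w, hw, iuv, iuw, ivw⟩ := exists_face_of_slot hu
  obtain ⟨hnorm, hmenu, hfar⟩ := faceNormal_props hu hv hw iuv iuw ivw
  refine ⟨A ((1 / Real.sqrt 6) • (u + v + w)), by rw [LinearIsometryEquiv.norm_map, hnorm], ?_, ?_⟩
  · intro x hx
    rw [LinearIsometryEquiv.inner_map_map]
    exact hmenu x hx
  · rw [LinearIsometryEquiv.inner_map_map]; exact hfar

/-- **Norm identity for a vector read off a face.**  If `a, b, c` is a face and `x = ⟪a, μ'⟫`, `y = ⟪b, μ'⟫`,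
`z = ⟪c, μ'⟫`, then `‖μ'‖² = 2(x² + y² + z²) − (x + y + z)²/2`. -/
theorem norm_sq_of_inner_face {a b c μ' : EuclideanSpace ℝ (Fin 3)} (ha : a ∈ fccSlots) (hb : b ∈ fccSlots)
    (hc : c ∈ fccSlots) (iab : ⟪a, b⟫_ℝ = 1 / 2) (iac : ⟪a, c⟫_ℝ = 1 / 2) (ibc : ⟪b, c⟫_ℝ = 1 / 2) :
    ‖μ'‖ ^ 2 = 2 * (⟪a, μ'⟫_ℝ ^ 2 + ⟪b, μ'⟫_ℝ ^ 2 + ⟪c, μ'⟫_ℝ ^ 2) - (⟪a, μ'⟫_ℝ + ⟪b, μ'⟫_ℝ + ⟪c, μ'⟫_ℝ) ^ 2 / 2 := by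
  have haa : ⟪a, a⟫_ℝ = 1 := by rw [real_inner_self_eq_norm_sq, norm_eq_one_of_mem_fccSlots ha, one_pow]
  have hbb : ⟪b, b⟫_ℝ = 1 := by rw [real_inner_self_eq_norm_sq, norm_eq_one_of_mem_fccSlots hb, one_pow]
  have hcc : ⟪c, c⟫_ℝ = 1 := by rw [real_inner_self_eq_norm_sq, norm_eq_one_of_mem_fccSlots hc, one_pow]
  have iba : ⟪b, a⟫_ℝ = 1 / 2 := by rw [real_inner_comm]; exact iab
  have ica : ⟪c, a⟫_ℝ = 1 / 2 := by rw [real_inner_comm]; exact iac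
  have icb : ⟪c, b⟫_ℝ = 1 / 2 := by rw [real_inner_comm]; exact ibc
  set x := ⟪a, μ'⟫_ℝ with hx
  set y := ⟪b, μ'⟫_ℝ with hy
  set z := ⟪c, μ'⟫_ℝ with hz
  -- the candidate expansion
  set ν := (2 * x - (x + y + z) / 2) • a + (2 * y - (x + y + z) / 2) • b + (2 * z - (x + y + z) / 2) • c with hν
  have hind := linearIndependent_of_pairwise_half ha hb hc iab iac ibc
  have hzero : μ' - ν = 0 := by
    refine eq_zero_of_inner_eq_zero_of_indep hind ?_ ?_ ?_
    · rw [inner_sub_right, ← hx, hν]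
      simp only [inner_add_right, real_inner_smul_right, haa, iab, iac]; ring
    · rw [inner_sub_right, ← hy, hν]
      simp only [inner_add_right, real_inner_smul_right, hbb, iba, ibc]; ring
    · rw [inner_sub_right, ← hz, hν]
      simp only [inner_add_right, real_inner_smul_right, hcc, ica, icb]; ring
  have hμ : μ' = ν := sub_eq_zero.1 hzero
  have key : ‖μ'‖ ^ 2 = ⟪ν, μ'⟫_ℝ := by rw [← real_inner_self_eq_norm_sq, ← hμ]
  rw [key, hν]
  simp only [inner_add_left, real_inner_smul_left]
  ring

/-- **Two menu normals of one frame meet at `±1` or `±1/3`.**  See the module docstring. -/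
theorem inner_menuNormals (A : EuclideanSpace ℝ (Fin 3) ≃ₗᵢ[ℝ] EuclideanSpace ℝ (Fin 3))
    {m m' : EuclideanSpace ℝ (Fin 3)} (hm : ‖m‖ = 1) (hm' : ‖m'‖ = 1)
    (hmenu : ∀ w ∈ fccSlots, ⟪A w, m⟫_ℝ = 0 ∨ ⟪A w, m⟫_ℝ = Real.sqrt (2 / 3) ∨ ⟪A w, m⟫_ℝ = -Real.sqrt (2 / 3))
    (hmenu' : ∀ w ∈ fccSlots, ⟪A w, m'⟫_ℝ = 0 ∨ ⟪A w, m'⟫_ℝ = Real.sqrt (2 / 3) ∨ ⟪A w, m'⟫_ℝ = -Real.sqrt (2 / 3)) :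
    ⟪m, m'⟫_ℝ = 1 ∨ ⟪m, m'⟫_ℝ = -1 ∨ ⟪m, m'⟫_ℝ = 1 / 3 ∨ ⟪m, m'⟫_ℝ = -1 / 3 := by
  have h23 : Real.sqrt (2 / 3) ^ 2 = 2 / 3 := Real.sq_sqrt (by norm_num)
  have hr : 0 < Real.sqrt (2 / 3) := Real.sqrt_pos.2 (by norm_num)
  -- the far face of `m` and the pulled-back normal `μ' = A⁻¹ m'`
  obtain ⟨a, ha, b, hb, c, hc, hna, hnb, hnc, iab, iac, ibc, -, -⟩ := exists_far_frame A hm hmenu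
  set μ' : EuclideanSpace ℝ (Fin 3) := A.symm m' with hμ'
  have hAμ : ∀ w, ⟪A w, m'⟫_ℝ = ⟪w, μ'⟫_ℝ := by
    intro w
    rw [hμ', ← LinearIsometryEquiv.inner_map_map A w (A.symm m'), LinearIsometryEquiv.apply_symm_apply]
  have hnμ : ‖μ'‖ = 1 := by rw [hμ', LinearIsometryEquiv.norm_map, hm']
  -- the sum identity: `⟪a, μ'⟫ + ⟪b, μ'⟫ + ⟪c, μ'⟫ = √6 ⟪m, m'⟫`
  have hsum := sum_far_inner A hm ha hb hc hna hnb hnc iab iac ibc m'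
  rw [hAμ, hAμ, hAμ] at hsum
  have hs6 : Real.sqrt 6 = 3 * Real.sqrt (2 / 3) := by
    rw [show (6 : ℝ) = 3 ^ 2 * (2 / 3) by norm_num, Real.sqrt_mul (by norm_num), Real.sqrt_sq (by norm_num)]
  -- the norm identity
  have hnid := norm_sq_of_inner_face (μ' := μ') ha hb hc iab iac ibc
  rw [hnμ, one_pow] at hnid
  -- integer labels `εᵢ ∈ {0, ±1}` with `⟪aᵢ, μ'⟫ = εᵢ √(2/3)`
  have lab : ∀ w ∈ fccSlots, ∃ e : ℤ, (e = 0 ∨ e = 1 ∨ e = -1) ∧ ⟪w, μ'⟫_ℝ = e * Real.sqrt (2 / 3) := by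
    intro w hw
    rcases hmenu' w hw with h | h | h <;> rw [hAμ] at h
    · exact ⟨0, Or.inl rfl, by rw [h]; simp⟩
    · exact ⟨1, Or.inr (Or.inl rfl), by rw [h]; simp⟩
    · exact ⟨-1, Or.inr (Or.inr rfl), by rw [h]; simp⟩
  obtain ⟨e₁, he₁, hx⟩ := lab a ha
  obtain ⟨e₂, he₂, hy⟩ := lab b hb
  obtain ⟨e₃, he₃, hz⟩ := lab c hc
  rw [hx, hy, hz] at hnid hsum
  -- the norm identity in integers: `4 Σ εᵢ² − (Σ εᵢ)² = 3`
  have hintR : (4 * (e₁ ^ 2 + e₂ ^ 2 + e₃ ^ 2) - (e₁ + e₂ + e₃) ^ 2 : ℝ) = 3 := by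
    have h := hnid
    ring_nf at h
    rw [h23] at h
    linarith
  have hintZ : 4 * (e₁ ^ 2 + e₂ ^ 2 + e₃ ^ 2) - (e₁ + e₂ + e₃) ^ 2 = 3 := by exact_mod_cast hintR
  -- the inner product from the sum identity
  have hmm : ⟪m, m'⟫_ℝ = ((e₁ + e₂ + e₃ : ℤ) : ℝ) / 3 := by
    rw [hs6] at hsum
    have h3 : Real.sqrt (2 / 3) * (3 * ⟪m, m'⟫_ℝ - (e₁ + e₂ + e₃)) = 0 := by linarith
    rcases mul_eq_zero.1 h3 with h | h
    · exact absurd h hr.ne'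
    · push_cast; linarith
  rw [hmm]
  rcases he₁ with rfl | rfl | rfl <;> rcases he₂ with rfl | rfl | rfl <;> rcases he₃ with rfl | rfl | rfl <;>
    (norm_num at hintZ; try norm_num)

end Summit.Ventures.Crystal3D.Theorems

end
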